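import Mathlib
import Summits.Ventures.PercRepro2.K2nPointSplitRefutation

/-!
# (PS) is FALSE: `PointSplitBHK` fails on `K_{2,21}` with a pendant leaf at the hub
(blind cell PercRepro2, night-3 g27, 2026-08-29; `proofs/NIGHT3-CERT.md` §36.11)

`K_{2,n}` plus a pendant leaf `w` attached to the hub `v = 1` by an edge of weight `q`.  The leaf
never mediates a connection, so connectivity among the old vertices is that of `K_{2,n}`
(`conn_old_iff`), and `w ∈ C_s` iff the leaf edge is open and `s ↔ v` (`w_mem_cluster_iff`).
Expectations over the extended configuration space split on the leaf edge (`expect_ext`), and with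
the split point `w` the four expectations of the cross form `M(1_{w ∈ C_s}, 1_{w ∉ C_s})` of
`CovForm.PointSplit.PointSplitBHK` are `q`-multiples of the closed forms of `K_{2,n}`:
`M(1_w, 1_w̄) = q·Φ − 2q²·S_u` with `Φ = psForm n a` the (PS1) form and `S_u` the `u`-class slack.
At `n = 21`, `a = 10`, `q = 1/1000` the value is `−266179767235917869191 / 9671406556917033397649408000000 < 0`
(`not_pointSplitBHK_K2_21_leaf`): the candidate (PS) of `PointSplitBHK.lean` (§32.3) is refuted in
the kernel.  Own work; standard axioms.
-/

namespace Summit.Ventures.PercRepro2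

namespace K2nLeaf

open K2n

/-- The old vertices of `K_{2,n}` inside the extended vertex type. -/
def old {n : ℕ} (x : Fin (n + 2)) : Fin (n + 3) := Fin.castSucc x

/-- The pendant leaf. -/
def w (n : ℕ) : Fin (n + 3) := Fin.last (n + 2)

/-- `old` is injective. -/
lemma old_injective {n : ℕ} : Function.Injective (old (n := n)) := Fin.castSucc_injective _

/-- The leaf is not an old vertex. -/
lemma old_ne_w {n : ℕ} (x : Fin (n + 2)) : old x ≠ w n := Fin.castSucc_lt_last x |>.ne

/-- Every vertex is old or the leaf. -/
lemma eq_old_or_w {n : ℕ} (z : Fin (n + 3)) : (∃ x, z = old x) ∨ z = w n :=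
  Fin.eq_castSucc_or_eq_last z

/-- The edges: `some e` the edges of `K_{2,n}`, `none` the leaf edge `{v, w}`. -/
def ends' (n : ℕ) : Option (Fin n × Bool) → Sym2 (Fin (n + 3)) :=
  fun e => match e with
    | none => s(old 1, w n)
    | some e => Sym2.map old (ends n e)

/-- The leaf edge. -/
@[simp] lemma ends'_none {n : ℕ} : ends' n none = s(old 1, w n) := rfl

/-- An old edge. -/
@[simp] lemma ends'_some {n : ℕ} (e : Fin n × Bool) : ends' n (some e) = Sym2.map old (ends n e) :=
  rfl

/-- Extending a configuration of `K_{2,n}` by the state `b` of the leaf edge. -/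
def ext {n : ℕ} (ω : Config (Fin n × Bool)) (b : Bool) : Config (Option (Fin n × Bool)) :=
  fun e => match e with
    | none => b
    | some e => ω e

/-- Evaluation of `ext` at the leaf edge. -/
@[simp] lemma ext_none {n : ℕ} (ω : Config (Fin n × Bool)) (b : Bool) : ext ω b none = b := rfl

/-- Evaluation of `ext` at an old edge. -/
@[simp] lemma ext_some {n : ℕ} (ω : Config (Fin n × Bool)) (b : Bool) (e : Fin n × Bool) :
    ext ω b (some e) = ω e := rfl

/-- Open adjacency in the extended graph. -/
lemma openAdj'_iff {n : ℕ} (ω : Config (Fin n × Bool)) (b : Bool) (x y : Fin (n + 3)) :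
    OpenAdj (ends' n) (ext ω b) x y ↔
      (∃ x' y', x = old x' ∧ y = old y' ∧ OpenAdj (ends n) ω x' y') ∨
      (b = true ∧ ((x = old 1 ∧ y = w n) ∨ (x = w n ∧ y = old 1))) := by
  constructor
  · rintro ⟨e, he, hends⟩
    cases e with
    | none =>
      right
      refine ⟨he, ?_⟩
      rw [ends'_none, Sym2.eq_iff] at hends
      rcases hends with ⟨h1, h2⟩ | ⟨h1, h2⟩
      · exact Or.inl ⟨h1.symm, h2.symm⟩
      · exact Or.inr ⟨h2.symm, h1.symm⟩
    | some e =>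
      left
      rw [ends'_some] at hends
      obtain ⟨x', y', hxy⟩ : ∃ x' y', ends n e = s(x', y') := by
        rcases e with ⟨ℓ, b'⟩
        cases b'
        · exact ⟨0, leaf ℓ, rfl⟩
        · exact ⟨leaf ℓ, 1, rfl⟩
      rw [hxy, Sym2.map_mk, Sym2.eq_iff] at hends
      rcases hends with ⟨h1, h2⟩ | ⟨h1, h2⟩
      · exact ⟨x', y', h1.symm, h2.symm, e, he, hxy⟩
      · exact ⟨y', x', h2.symm, h1.symm, e, he, by rw [hxy, Sym2.eq_swap]⟩
  · rintro (⟨x', y', rfl, rfl, e, he, hxy⟩ | ⟨hb, ⟨rfl, rfl⟩ | ⟨rfl, rfl⟩⟩)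
    · exact ⟨some e, he, by rw [ends'_some, hxy, Sym2.map_mk]⟩
    · exact ⟨none, hb, rfl⟩
    · exact ⟨none, hb, by rw [ends'_none, Sym2.eq_swap]⟩

/-- **Closure**: everything connected to an old vertex `x` in the extended graph is an old vertex
connected to `x` in `K_{2,n}`, or the leaf when its edge is open and `x ↔ v`. -/
lemma mem_cluster_ext {n : ℕ} (ω : Config (Fin n × Bool)) (b : Bool) (x : Fin (n + 2))
    {z : Fin (n + 3)} (hz : z ∈ cluster (ends' n) (ext ω b) (old x)) :
    (∃ x', z = old x' ∧ Conn (ends n) ω x x') ∨ (z = w n ∧ b = true ∧ Conn (ends n) ω x 1) := by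
  let S : Set (Fin (n + 3)) :=
    {z | (∃ x', z = old x' ∧ Conn (ends n) ω x x') ∨ (z = w n ∧ b = true ∧ Conn (ends n) ω x 1)}
  have hS : ∀ y ∈ S, ∀ y', (openGraph (ends' n) (ext ω b)).Adj y y' → y' ∈ S := by
    intro y hy y' hyy'
    rw [openGraph_adj] at hyy'
    obtain ⟨-, hadj⟩ := hyy'
    rw [openAdj'_iff] at hadj
    rcases hadj with ⟨a, c, rfl, rfl, hac⟩ | ⟨hb, ⟨rfl, rfl⟩ | ⟨rfl, rfl⟩⟩
    · rcases hy with ⟨a', ha', hconn⟩ | ⟨hw, -, -⟩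
      · have := old_injective ha'
        subst this
        exact Or.inl ⟨c, rfl, conn_trans hconn (conn_of_openAdj hac)⟩
      · exact absurd hw (old_ne_w a)
    · rcases hy with ⟨a', ha', hconn⟩ | ⟨hw, -, -⟩
      · have := old_injective ha'
        subst this
        exact Or.inr ⟨rfl, hb, hconn⟩
      · exact absurd hw (old_ne_w 1)
    · rcases hy with ⟨a', ha', -⟩ | ⟨-, -, hconn⟩
      · exact absurd ha'.symm (old_ne_w a')
      · exact Or.inl ⟨1, rfl, hconn⟩
  exact mem_of_conn_of_closed hS (Or.inl ⟨x, rfl, conn_refl _ _ _⟩) hz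

/-- Connectivity among old vertices is that of `K_{2,n}`. -/
theorem conn_old_iff {n : ℕ} (ω : Config (Fin n × Bool)) (b : Bool) (x y : Fin (n + 2)) :
    Conn (ends' n) (ext ω b) (old x) (old y) ↔ Conn (ends n) ω x y := by
  constructor
  · intro h
    rcases mem_cluster_ext ω b x h with ⟨y', hy', hc⟩ | ⟨hw, -, -⟩
    · have := old_injective hy'
      subst this
      exact hc
    · exact absurd hw (old_ne_w y)
  · intro h
    rw [Conn, SimpleGraph.reachable_iff_reflTransGen] at h ⊢
    induction h with
    | refl => exact Relation.ReflTransGen.refl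
    | tail _ hxy ih =>
      refine Relation.ReflTransGen.tail ih ?_
      rw [openGraph_adj] at hxy ⊢
      obtain ⟨hne, hadj⟩ := hxy
      exact ⟨fun h => hne (old_injective h), (openAdj'_iff ω b _ _).2 (Or.inl ⟨_, _, rfl, rfl, hadj⟩)⟩

/-- The leaf lies in `C_s` iff its edge is open and `s ↔ v`. -/
theorem w_mem_cluster_iff {n : ℕ} (ω : Config (Fin n × Bool)) (b : Bool) :
    w n ∈ cluster (ends' n) (ext ω b) (old 0) ↔ (b = true ∧ Conn (ends n) ω 0 1) := by
  constructor
  · intro h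
    rcases mem_cluster_ext ω b 0 h with ⟨x', hx', -⟩ | ⟨-, hb, hc⟩
    · exact absurd hx'.symm (old_ne_w x')
    · exact ⟨hb, hc⟩
  · rintro ⟨hb, hc⟩
    have h1 : Conn (ends' n) (ext ω b) (old 0) (old 1) := (conn_old_iff ω b 0 1).2 hc
    have h2 : OpenAdj (ends' n) (ext ω b) (old 1) (w n) :=
      (openAdj'_iff ω b _ _).2 (Or.inr ⟨hb, Or.inl ⟨rfl, rfl⟩⟩)
    exact conn_trans h1 (conn_of_openAdj h2)

/-- Every extended configuration is an `ext`. -/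
lemma exists_ext {n : ℕ} (ω' : Config (Option (Fin n × Bool))) :
    ∃ ω b, ω' = ext ω b := by
  refine ⟨fun e => ω' (some e), ω' none, funext fun e => ?_⟩
  cases e <;> rfl

/-! ## The weights and the expectation split on the leaf edge -/

/-- Weight `1/2` on the route edges and `q` on the leaf edge. -/
def pLeaf (n : ℕ) (q : ℚ) : Option (Fin n × Bool) → ℚ :=
  fun e => match e with
    | none => q
    | some _ => 1 / 2

/-- `pLeaf` is admissible for `0 ≤ q ≤ 1`. -/
lemma isProbVec_pLeaf (n : ℕ) {q : ℚ} (h0 : 0 ≤ q) (h1 : q ≤ 1) : IsProbVec (pLeaf n q) := by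
  refine ⟨fun e => ?_, fun e => ?_⟩ <;> cases e <;> norm_num [pLeaf, h0, h1]

/-- The weight of an extended configuration. -/
lemma weight_pLeaf {n : ℕ} (q : ℚ) (ω : Config (Fin n × Bool)) (b : Bool) :
    weight (pLeaf n q) (ext ω b) = edgeFactor q b * (1 / 4 : ℚ) ^ n := by
  unfold weight
  rw [Fintype.prod_option]
  simp only [ext_none, ext_some, pLeaf]
  congr 1
  have := weight_half (n := n) ω
  unfold weight at this
  simpa [half] using this

/-- **The expectation splits on the leaf edge.** -/
theorem expect_ext {n : ℕ} (q : ℚ) (f : Config (Option (Fin n × Bool)) → ℚ) :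
    expect (pLeaf n q) f =
      q * expect (half n) (fun ω => f (ext ω true)) +
        (1 - q) * expect (half n) (fun ω => f (ext ω false)) := by
  unfold expect
  rw [Fintype.sum_equiv (Equiv.piOptionEquivProd (α := Fin n × Bool) (β := fun _ => Bool))
    (fun ω' => weight (pLeaf n q) ω' * f ω')
    (fun x => weight (pLeaf n q) (ext x.2 x.1) * f (ext x.2 x.1)) (fun ω' => by
      obtain ⟨ω, b, rfl⟩ := exists_ext ω'
      rfl)]
  rw [Fintype.sum_prod_type, Fintype.sum_bool]
  simp only [weight_pLeaf, weight_half, edgeFactor_true, edgeFactor_false, Finset.mul_sum]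
  refine congrArg₂ _ (Finset.sum_congr rfl fun ω _ => by ring) (Finset.sum_congr rfl fun ω _ => by ring)

/-! ## The functionals and the four expectations -/

/-- The leaf `ℓ` of `K_{2,n}` as a vertex of the extended graph. -/
def leaf' {n : ℕ} (ℓ : Fin n) : Fin (n + 3) := old (leaf ℓ)

open Classical in
/-- The principal functional of the leaves `B` on the extended vertex set. -/
noncomputable def FA' {n : ℕ} (B : Finset (Fin n)) : Set (Fin (n + 3)) → ℚ :=
  fun S => if ∀ ℓ ∈ B, leaf' ℓ ∈ S then 1 else 0

/-- `FA'` is increasing. -/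
lemma monotone_FA' {n : ℕ} (B : Finset (Fin n)) : Monotone (FA' B) := by
  intro S T hST
  unfold FA'
  split_ifs with h1 h2 <;> norm_num
  exact h2 fun ℓ hℓ => hST (h1 ℓ hℓ)

/-- `FA'` is nonnegative. -/
lemma FA'_nonneg {n : ℕ} (B : Finset (Fin n)) (S : Set (Fin (n + 3))) : 0 ≤ FA' B S := by
  unfold FA'
  split_ifs <;> norm_num

/-- On the cluster of `s` the extended functional is the old one. -/
lemma FA'_cluster {n : ℕ} (B : Finset (Fin n)) (ω : Config (Fin n × Bool)) (b : Bool) :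
    FA' B (cluster (ends' n) (ext ω b) (old 0)) = FA B (cluster (ends n) ω 0) := by
  unfold FA' FA
  have h : ∀ ℓ, leaf' ℓ ∈ cluster (ends' n) (ext ω b) (old 0) ↔ leaf ℓ ∈ cluster (ends n) ω 0 :=
    fun ℓ => conn_old_iff ω b 0 (leaf ℓ)
  by_cases hP : ∀ ℓ ∈ B, leaf ℓ ∈ cluster (ends n) ω 0
  · rw [if_pos hP, if_pos (fun ℓ hℓ => (h ℓ).2 (hP ℓ hℓ))]
  · rw [if_neg hP, if_neg (fun hall => hP fun ℓ hℓ => (h ℓ).1 (hall ℓ hℓ))]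

/-- The indicator of `{w ∈ C_s}` on an extended configuration. -/
lemma indicator_w_apply {n : ℕ} (ω : Config (Fin n × Bool)) (b : Bool) :
    (connEvent (ends' n) (old 0) (w n)).indicator (1 : Config (Option (Fin n × Bool)) → ℚ)
        (ext ω b) =
      (if b then 1 else 0) * (if Conn (ends n) ω 0 1 then 1 else 0) := by
  by_cases h : w n ∈ cluster (ends' n) (ext ω b) (old 0)
  · rw [Set.indicator_of_mem (show ext ω b ∈ connEvent (ends' n) (old 0) (w n) from h)]
    obtain ⟨hb, hc⟩ := (w_mem_cluster_iff ω b).1 h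
    simp [hb, hc]
  · rw [Set.indicator_of_notMem (show ext ω b ∉ connEvent (ends' n) (old 0) (w n) from h)]
    rw [w_mem_cluster_iff] at h
    push Not at h
    cases b
    · simp
    · simp [h rfl]

/-- The indicator of `{w ∉ C_s}` on an extended configuration. -/
lemma indicator_w_compl_apply {n : ℕ} (ω : Config (Fin n × Bool)) (b : Bool) :
    ((connEvent (ends' n) (old 0) (w n))ᶜ).indicator (1 : Config (Option (Fin n × Bool)) → ℚ)
        (ext ω b) =
      1 - (if b then 1 else 0) * (if Conn (ends n) ω 0 1 then 1 else 0) := by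
  rw [← indicator_w_apply]
  by_cases h : ext ω b ∈ connEvent (ends' n) (old 0) (w n)
  · rw [Set.indicator_of_notMem (show ext ω b ∉ (connEvent (ends' n) (old 0) (w n))ᶜ from
      fun h' => h' h), Set.indicator_of_mem h]
    simp
  · rw [Set.indicator_of_mem (show ext ω b ∈ (connEvent (ends' n) (old 0) (w n))ᶜ from h),
      Set.indicator_of_notMem h]
    simp

/-- `F'_A · F'_{Aᶜ} = F'_{univ}`. -/
lemma FA'_mul_FA'_compl {n : ℕ} (A : Finset (Fin n)) (S : Set (Fin (n + 3))) :
    FA' A S * FA' Aᶜ S = FA' Finset.univ S := by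
  unfold FA'
  by_cases h : ∀ ℓ ∈ (Finset.univ : Finset (Fin n)), leaf' ℓ ∈ S
  · rw [if_pos h, if_pos (fun ℓ _ => h ℓ (Finset.mem_univ ℓ)),
      if_pos (fun ℓ _ => h ℓ (Finset.mem_univ ℓ))]
    norm_num
  · rw [if_neg h]
    push Not at h
    obtain ⟨ℓ₀, -, hℓ₀⟩ := h
    by_cases hA : ℓ₀ ∈ A
    · rw [if_neg (show ¬ ∀ ℓ ∈ A, leaf' ℓ ∈ S from fun hall => hℓ₀ (hall ℓ₀ hA)), zero_mul]
    · rw [if_neg (show ¬ ∀ ℓ ∈ Aᶜ, leaf' ℓ ∈ S from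
        fun hall => hℓ₀ (hall ℓ₀ (Finset.mem_compl.2 hA))), mul_zero]

/-- `E'[F'_B · 1_{w ∈ C}] = q · E[F_B · 1_{s ↔ v}]`. -/
lemma expect_FA'_w {n : ℕ} (q : ℚ) (B : Finset (Fin n)) :
    expect (pLeaf n q) (fun ω' => FA' B (cluster (ends' n) ω' (old 0)) *
        (connEvent (ends' n) (old 0) (w n)).indicator 1 ω') =
      q * expect (half n) (fun ω => FA B (cluster (ends n) ω 0) *
        (if Conn (ends n) ω 0 1 then (1 : ℚ) else 0)) := by
  rw [expect_ext]
  simp only [FA'_cluster, indicator_w_apply, Bool.false_eq_true, if_true, if_false, one_mul,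
    zero_mul, mul_zero, expect_const, add_zero]

/-- `E'[F'_B · 1_{w ∉ C}] = E[F_B] − q · E[F_B · 1_{s ↔ v}]`. -/
lemma expect_FA'_wc {n : ℕ} (q : ℚ) (B : Finset (Fin n)) :
    expect (pLeaf n q) (fun ω' => FA' B (cluster (ends' n) ω' (old 0)) *
        ((connEvent (ends' n) (old 0) (w n))ᶜ).indicator 1 ω') =
      expect (half n) (fun ω => FA B (cluster (ends n) ω 0)) -
        q * expect (half n) (fun ω => FA B (cluster (ends n) ω 0) *
          (if Conn (ends n) ω 0 1 then (1 : ℚ) else 0)) := by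
  rw [expect_ext]
  simp only [FA'_cluster, indicator_w_compl_apply, Bool.false_eq_true, if_true, if_false, one_mul,
    zero_mul, sub_zero, mul_one]
  rw [show (fun ω => FA B (cluster (ends n) ω 0) * (1 - if Conn (ends n) ω 0 1 then (1 : ℚ) else 0)) =
      (fun ω => FA B (cluster (ends n) ω 0) -
        FA B (cluster (ends n) ω 0) * (if Conn (ends n) ω 0 1 then (1 : ℚ) else 0)) from
      funext fun ω => by ring, expect_sub']
  ring

/-- `P'(w ∈ C) = q · P(s ↔ v)`. -/
lemma expect_one_w {n : ℕ} (q : ℚ) :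
    expect (pLeaf n q) (fun ω' => (1 : ℚ) * (connEvent (ends' n) (old 0) (w n)).indicator 1 ω') =
      q * expect (half n) (fun ω => if Conn (ends n) ω 0 1 then (1 : ℚ) else 0) := by
  rw [expect_ext]
  simp only [indicator_w_apply, Bool.false_eq_true, if_true, if_false, one_mul, zero_mul,
    mul_zero, expect_const, add_zero]

/-- `P'(w ∉ C) = 1 − q · P(s ↔ v)`. -/
lemma expect_one_wc {n : ℕ} (q : ℚ) :
    expect (pLeaf n q) (fun ω' => (1 : ℚ) * ((connEvent (ends' n) (old 0) (w n))ᶜ).indicator 1 ω') =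
      1 - q * expect (half n) (fun ω => if Conn (ends n) ω 0 1 then (1 : ℚ) else 0) := by
  rw [expect_ext]
  simp only [indicator_w_compl_apply, Bool.false_eq_true, if_true, if_false, one_mul, zero_mul,
    sub_zero, mul_one, expect_const]
  rw [show (fun ω => (1 : ℚ) - if Conn (ends n) ω 0 1 then (1 : ℚ) else 0) =
      (fun ω => (1 : ℚ) - (if Conn (ends n) ω 0 1 then (1 : ℚ) else 0)) from rfl, expect_sub',
    expect_const]
  ring

/-- **(PS) is false**: on `K_{2,21}` with a pendant leaf `w` at the hub (leaf edge weight
`1/1000`, route edges `1/2`), `X = Y = ∅`, the split point `w` and the principal functionals of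
the `10 + 11` split, the cross form `M(1_{w ∈ C_s}, 1_{w ∉ C_s})` of
`CovForm.PointSplit.PointSplitBHK` is negative
(`= −266179767235917869191 / 9671406556917033397649408000000 ≈ −2.75 × 10⁻¹¹`). -/
theorem not_pointSplitBHK_K2_21_leaf :
    ¬ CovForm.PointSplit.PointSplitBHK (R := ℚ) (ends' 21) (old 0) := by
  intro h
  have hv := h (pLeaf 21 (1 / 1000)) (isProbVec_pLeaf 21 (by norm_num) (by norm_num)) ∅ ∅ (w 21)
    (FA' (leftLeaves 21 10)) (FA' (leftLeaves 21 10)ᶜ) (monotone_FA' _) (monotone_FA' _)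
    (FA'_nonneg _) (FA'_nonneg _)
  unfold CovForm.PointSplit.mixedFormW at hv
  simp only [Finset.inter_self, Finset.union_self, CovForm.PointSplit.wExpect_empty,
    FA'_mul_FA'_compl, expect_FA'_w, expect_FA'_wc, expect_one_w, expect_one_wc, expect_FA_conn,
    expect_FA, expect_conn, Finset.card_univ, Fintype.card_fin] at hv
  have hc : (leftLeaves 21 10).card = 10 := by decide
  have hc' : (leftLeaves 21 10)ᶜ.card = 11 := by decide
  rw [hc, hc'] at hv
  norm_num at hv

end K2nLeaf

end Summit.Ventures.PercRepro2
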